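import Literature.NumberTheory.IwasawaTheory.PSCyclotomicLFunction
import Literature.NumberTheory.EllipticCurves.CyclotomicInterpolantUniquenessProofs
import Mathlib.NumberTheory.LegendreSymbol.AddCharacter
import HarnessLib

/-!
# Višik uniqueness in the ball-value currency: an additive system on `Γ` is determined by its
# values at the characters of `Γ`; hence the untwisted `p`-adic `L`-function of D1
# (`IsUntwistedPAdicLFunction`, `IsPSCyclotomicLFunctionOf`) is UNIQUE

Cell `pub/bsd-wall` (D-0145 line `route-BirchSwinnertonDyer-CyclotomicUntwist`), seat `bsd-line-cycu-p1`
(prover seat 1/3), helper toward crux K1 `PSRankOneLowerHalfAtThree` (stmt-BirchSwinnertonDyer-21580).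
THEOREMS ONLY (no definition, no named fact, no `sorry`). BSD is not proved by this file and no crux
of the route is proved by it.

WHY. D1 (`Literature/NumberTheory/IwasawaTheory/PSCyclotomicLFunction.lean`) types the finite-slope
`3`-adic `L`-function of the untwist as a PREDICATE on ball values, promising in its docstring that the
interpolation clause makes the object "UNIQUE given (3)" (Bellaïche Thm. 6.2.13 (i), Višik / Amice–Vélu)
and supplying only the input `IsUntwistedPAdicLFunction.gammaCharValue_eq`. The cruxes GZ₃ (about the
modular-symbol `L`-function) and IMC₃ (about the `L`-function an Euler-system argument produces) of K1's
two-layer plan speak of a priori DIFFERENT witnesses of the same predicate; this file proves they are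
equal, so the predicate names ONE object:

* §1 `sum_pow_val_mul_eq_of_le` — level change of the twisted sums `Σ_{s mod p^b} ζ^{s̃} δ(γ^s Γ^{p^b})`
  of an ADDITIVE system (`= Σ_{s mod p^a} …` once `ζ^{p^a} = 1`, `a ≤ b`);
* §2 `sum_pow_val_mul_eq_zero` — if `∫_Γ ξ dδ = 0` for every primitive even `ξ` of `p`-power order and
  level (`𝟙` included), every twisted sum vanishes: each `p`-power root of unity `ζ ≠ 1` is `χ(γ)` for
  such a `χ` (tree theorem `exists_character_apply_cyclotomicGenerator_eq`, from the Teichmüller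
  decomposition `(ℤ/p^{n+e₀})^× = μ_τ × ⟨γ⟩`);
* §3 `eq_zero_of_forall_sum_pow_val_mul_eq_zero` — Fourier inversion on `ℤ/p^L` (Mathlib
  `AddChar.zmodChar`, `AddChar.sum_mulShift`, a primitive `p^L`-th root of unity in the algebraically
  closed `ℂ_p`), and **`eq_of_forall_gammaCharValue_eq`**: two additive systems with the same values at
  the characters of `Γ` are equal (no growth hypothesis needed in the ball-value encoding);
* §4 `exists_isPrimitive_apply_eq_inv_mul` (the primitive character of `η̄ξ` at a `p`-power level,
  Mathlib `primitiveCharacter`), **`eq_of_isUntwistedPAdicLFunction`** (two ball systems with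
  `IsUntwistedPAdicLFunction p f η α` are equal — unconditional) and `eq_of_isPSCyclotomicLFunctionOf`
  (the `W`-level statement, CONDITIONAL on Carayol's `IsNewformOf.level_eq_conductorNorm` exactly as the
  tree's `hasLambdaAnAt_iff_normLam_eq`, via `IsNewformOf.unique`).

References: [cite: Bellaiche2021, Thm. 6.2.13 (i) and Thm. 6.7.9] · [cite: MazurTateTeitelbaum1986Invent, §I.11, §I.13–§I.14]
· [cite: Carayol1986].
-/

noncomputable section

open Filter Topology Finset
open Literature.NumberTheory.EllipticCurves Literature.NumberTheory.EllipticCurves.ModularForms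
  Literature.NumberTheory.IwasawaTheory

-- single-conjunct summit: `Summit.BirchSwinnertonDyer.BirchSwinnertonDyer.…` repeats the name by design
set_option linter.dupNamespace false

namespace Summit.BirchSwinnertonDyer.BirchSwinnertonDyer.Theorems.PSGammaUniqueness

variable {p : ℕ} [Fact p.Prime]

/-! ### §1 Level change for the twisted sums `Σ_s ζ^{s̃} δ(γ^s Γ^{p^L})` -/

/-- Push-forward one level: if `ζ^{p^a} = 1`, the level-`(a+1)` twisted sum of an additive system equals
the level-`a` one. [cite: Bellaiche2021, Thm. 6.2.13 (6.2.2)] -/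
theorem sum_pow_val_mul_succ {δ : (n : ℕ) → ZMod (p ^ n) → ℂ_[p]} (hδ : IsGammaDistribution p δ)
    {ζ : ℂ_[p]} {a : ℕ} (hζ : ζ ^ (p ^ a) = 1) :
    ∑ t : ZMod (p ^ (a + 1)), ζ ^ t.val * δ (a + 1) t = ∑ s : ZMod (p ^ a), ζ ^ s.val * δ a s := by
  classical
  set π := ZMod.castHom (pow_dvd_pow p a.le_succ) (ZMod (p ^ a)) with hπ
  rw [← Finset.sum_fiberwise_of_maps_to (s := univ) (t := univ) (g := π) (fun x _ ↦ mem_univ (π x))]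
  refine Finset.sum_congr rfl fun s _ ↦ ?_
  have hfib : ∀ t ∈ univ.filter (fun t : ZMod (p ^ (a + 1)) ↦ π t = s),
      ζ ^ t.val * δ (a + 1) t = ζ ^ s.val * δ (a + 1) t := by
    intro t ht
    have hts : π t = s := (Finset.mem_filter.1 ht).2
    have hval : s.val = t.val % p ^ a := by
      rw [← hts, hπ, ZMod.castHom_apply, ZMod.cast_eq_val, ZMod.val_natCast]
    rw [hval, ← pow_eq_pow_mod _ hζ]
  rw [Finset.sum_congr rfl hfib, ← Finset.mul_sum, hδ a s]

/-- Iterated push-forward: for `ζ^{p^a} = 1` and `a ≤ b` the level-`b` twisted sum equals the level-`a`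
one. [cite: Bellaiche2021, Thm. 6.2.13 (6.2.2)] -/
theorem sum_pow_val_mul_eq_of_le {δ : (n : ℕ) → ZMod (p ^ n) → ℂ_[p]} (hδ : IsGammaDistribution p δ)
    {ζ : ℂ_[p]} {a b : ℕ} (hζ : ζ ^ (p ^ a) = 1) (hab : a ≤ b) :
    ∑ t : ZMod (p ^ b), ζ ^ t.val * δ b t = ∑ s : ZMod (p ^ a), ζ ^ s.val * δ a s := by
  induction b, hab using Nat.le_induction with
  | base => rfl
  | succ b hab ih =>
    have hζb : ζ ^ (p ^ b) = 1 := by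
      obtain ⟨c, hc⟩ := pow_dvd_pow p hab
      rw [hc, pow_mul, hζ, one_pow]
    rw [sum_pow_val_mul_succ hδ hζb, ih]

/-! ### §2 The twisted sums of an additive system with vanishing character values vanish -/

/-- The value at a character `χ` with `χ(γ) = ζ` is the twisted sum at `ζ`.
[cite: Bellaiche2021, §6.7.3] -/
theorem gammaCharValue_eq_sum_pow_val_mul (δ : (n : ℕ) → ZMod (p ^ n) → ℂ_[p]) {m : ℕ}
    (χ : DirichletCharacter ℂ_[p] (p ^ m)) :
    gammaCharValue p δ χ =
      ∑ s : ZMod (p ^ m), (χ (cyclotomicGenerator p : ZMod (p ^ m))) ^ s.val * δ m s := by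
  rw [gammaCharValue_def]
  refine Finset.sum_congr rfl fun s _ ↦ ?_
  rw [map_pow]

/-- **Vanishing character values kill every twisted sum**: if the additive system `δ` has
`∫_Γ ξ dδ = 0` for every primitive, even Dirichlet character `ξ` of `p`-power order and `p`-power level
(`ξ = 𝟙` at level `p^0` included), then `Σ_{s mod p^L} ζ^{s̃} δ(γ^s Γ^{p^L}) = 0` for every `L` and every
`p^L`-th root of unity `ζ` (every such `ζ ≠ 1` is `χ(γ)` for such a `χ`, tree theorem
`exists_character_apply_cyclotomicGenerator_eq`). [cite: Bellaiche2021, Thm. 6.2.13 (i)] -/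
theorem sum_pow_val_mul_eq_zero {δ : (n : ℕ) → ZMod (p ^ n) → ℂ_[p]} (hδ : IsGammaDistribution p δ)
    (h : ∀ (m : ℕ) (ξ : DirichletCharacter ℂ_[p] (p ^ m)), ξ.IsPrimitive → ξ.Even →
      (∃ j : ℕ, orderOf ξ = p ^ j) → gammaCharValue p δ ξ = 0)
    (L : ℕ) {ζ : ℂ_[p]} (hζ : ζ ^ (p ^ L) = 1) :
    ∑ s : ZMod (p ^ L), ζ ^ s.val * δ L s = 0 := by
  have hp : p.Prime := Fact.out
  by_cases h1 : ζ = 1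
  · subst h1
    have h0 := h 0 1 (by
        rw [DirichletCharacter.isPrimitive_def, DirichletCharacter.conductor_one, pow_zero])
      (by
        rw [DirichletCharacter.Even]
        exact MulChar.one_apply (isUnit_one.neg))
      ⟨0, by rw [pow_zero, orderOf_one]⟩
    rw [gammaCharValue_one] at h0
    rw [sum_pow_val_mul_eq_of_le hδ (a := 0) (by rw [pow_zero, pow_one]) (Nat.zero_le L)]
    rw [sum_zmod_pow_zero]
    simp [h0]
  · obtain ⟨k, -, hk⟩ := (Nat.dvd_prime_pow hp).mp (orderOf_dvd_of_pow_eq_one hζ)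
    have hk0 : k ≠ 0 := by
      rintro rfl
      rw [pow_zero, orderOf_eq_one_iff] at hk
      exact h1 hk
    obtain ⟨j, rfl⟩ : ∃ j, k = j + 1 := ⟨k - 1, by omega⟩
    have hprim : IsPrimitiveRoot ζ (p ^ (j + 1)) := hk ▸ IsPrimitiveRoot.orderOf ζ
    have hζj : ζ ^ (p ^ (j + 1)) = 1 := hprim.pow_eq_one
    have hjL : j + 1 ≤ L := by
      have hdvd : p ^ (j + 1) ∣ p ^ L := hk ▸ orderOf_dvd_of_pow_eq_one hζ
      exact (Nat.pow_dvd_pow_iff_le_right hp.one_lt).mp hdvd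
    obtain ⟨χ, hχp, hχe, hχo, hχγ⟩ := exists_character_apply_cyclotomicGenerator_eq j hprim
    have h0 := h _ χ hχp hχe hχo
    rw [gammaCharValue_eq_sum_pow_val_mul, hχγ,
      sum_pow_val_mul_eq_of_le hδ hζj (by omega : j + 1 ≤ j + 1 + cyclotomicExponent p)] at h0
    rw [sum_pow_val_mul_eq_of_le hδ hζj hjL, h0]

/-! ### §3 Fourier inversion on `ℤ/p^L` and the uniqueness theorem -/

/-- **Fourier inversion on `ℤ/p^L`**: a function whose twisted sums `Σ_s ζ^{s̃} f(s)` vanish at every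
`p^L`-th root of unity `ζ ∈ ℂ_p` is zero (orthogonality of the additive characters
`s ↦ ζ₀^{j s}`, `ζ₀` a primitive `p^L`-th root of unity, which exists in the algebraically closed `ℂ_p`).
[cite: Bellaiche2021, Thm. 6.2.13 (i)] -/
theorem eq_zero_of_forall_sum_pow_val_mul_eq_zero (L : ℕ) {f : ZMod (p ^ L) → ℂ_[p]}
    (h : ∀ ζ : ℂ_[p], ζ ^ (p ^ L) = 1 → ∑ s : ZMod (p ^ L), ζ ^ s.val * f s = 0) : f = 0 := by
  classical
  have hp : p.Prime := Fact.out
  haveI : NeZero (p ^ L) := ⟨pow_ne_zero _ hp.ne_zero⟩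
  obtain ⟨ζ₀, hζ₀⟩ := HasEnoughRootsOfUnity.exists_primitiveRoot ℂ_[p] (p ^ L)
  have hζ₀1 : ζ₀ ^ (p ^ L) = 1 := hζ₀.pow_eq_one
  set ψ : AddChar (ZMod (p ^ L)) ℂ_[p] := AddChar.zmodChar (p ^ L) hζ₀1 with hψ
  have hψprim : ψ.IsPrimitive := AddChar.zmodChar_primitive_of_primitive_root (p ^ L) hζ₀
  -- every twisted sum against `ψ(j ·)` vanishes
  have hj : ∀ j : ZMod (p ^ L), ∑ s : ZMod (p ^ L), ψ (j * s) * f s = 0 := by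
    intro j
    have hζj : (ζ₀ ^ j.val) ^ (p ^ L) = 1 := by rw [← pow_mul, mul_comm, pow_mul, hζ₀1, one_pow]
    have := h (ζ₀ ^ j.val) hζj
    refine (Finset.sum_congr rfl fun s _ ↦ ?_).trans this
    rw [hψ, AddChar.zmodChar_apply, ZMod.val_mul, ← pow_eq_pow_mod _ hζ₀1, pow_mul]
  funext t
  -- `Σ_j ψ(j · (-t)) · Σ_s ψ(j s) f s = Σ_s f s Σ_j ψ(j (s - t)) = p^L · f t`
  have key : ∑ j : ZMod (p ^ L), ψ (j * -t) * ∑ s : ZMod (p ^ L), ψ (j * s) * f s =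
      (p ^ L : ℕ) * f t := by
    calc ∑ j : ZMod (p ^ L), ψ (j * -t) * ∑ s : ZMod (p ^ L), ψ (j * s) * f s
        = ∑ s : ZMod (p ^ L), (∑ j : ZMod (p ^ L), ψ (j * (s - t))) * f s := by
          simp_rw [Finset.mul_sum, Finset.sum_mul]
          rw [Finset.sum_comm]
          refine Finset.sum_congr rfl fun s _ ↦ Finset.sum_congr rfl fun j _ ↦ ?_
          rw [mul_sub, sub_eq_add_neg, AddChar.map_add_eq_mul]
          ring
      _ = ∑ s : ZMod (p ^ L), (if s - t = 0 then (Fintype.card (ZMod (p ^ L)) : ℂ_[p]) else 0) * f s := by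
          refine Finset.sum_congr rfl fun s _ ↦ ?_
          rw [AddChar.sum_mulShift (s - t) hψprim]
          push_cast
          rfl
      _ = (p ^ L : ℕ) * f t := by
          simp only [sub_eq_zero, ZMod.card, ite_mul, zero_mul, Finset.sum_ite_eq', Finset.mem_univ,
            if_true]
  simp only [hj, mul_zero, Finset.sum_const_zero] at key
  have hpL : ((p ^ L : ℕ) : ℂ_[p]) ≠ 0 := by exact_mod_cast pow_ne_zero L hp.ne_zero
  exact (mul_eq_zero.mp key.symm).resolve_left hpL

/-- **Višik uniqueness in the ball-value currency**: two ADDITIVE systems of ball values on `Γ` with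
the same value at every primitive, even Dirichlet character of `p`-power order and `p`-power level
(the characters of `Γ`, `𝟙` included) are EQUAL — no growth hypothesis is needed once distributions
are encoded by their ball values (Bellaïche Thm. 6.2.13 (i): an order-`< 1` distribution is determined
by its values at the characters of `Γ`; the ball-value encoding of D1 makes this a finite Fourier
inversion level by level). [cite: Bellaiche2021, Thm. 6.2.13 (i)] [cite: MazurTateTeitelbaum1986Invent, §I.11] -/
theorem eq_of_forall_gammaCharValue_eq {μ μ' : (n : ℕ) → ZMod (p ^ n) → ℂ_[p]}
    (hμ : IsGammaDistribution p μ) (hμ' : IsGammaDistribution p μ')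
    (h : ∀ (m : ℕ) (ξ : DirichletCharacter ℂ_[p] (p ^ m)), ξ.IsPrimitive → ξ.Even →
      (∃ j : ℕ, orderOf ξ = p ^ j) → gammaCharValue p μ ξ = gammaCharValue p μ' ξ) :
    μ = μ' := by
  set δ : (n : ℕ) → ZMod (p ^ n) → ℂ_[p] := fun n s ↦ μ n s + -μ' n s with hδdef
  have hδ : IsGammaDistribution p δ := hμ.add hμ'.neg
  have hδ0 : ∀ (m : ℕ) (ξ : DirichletCharacter ℂ_[p] (p ^ m)), ξ.IsPrimitive → ξ.Even →
      (∃ j : ℕ, orderOf ξ = p ^ j) → gammaCharValue p δ ξ = 0 := by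
    intro m ξ h1 h2 h3
    rw [hδdef, gammaCharValue_add, gammaCharValue_neg, h m ξ h1 h2 h3, add_neg_cancel]
  funext L s
  have hL : (fun s : ZMod (p ^ L) ↦ δ L s) = 0 :=
    eq_zero_of_forall_sum_pow_val_mul_eq_zero L fun ζ hζ ↦ sum_pow_val_mul_eq_zero hδ hδ0 L hζ
  have := congrFun hL s
  simp only [hδdef, Pi.zero_apply, add_neg_eq_zero] at this
  exact this


/-! ### §4 The untwisted `p`-adic `L`-function (D1) is unique -/

/-- **The primitive character of `η̄ξ` exists at a `p`-power level**: for Dirichlet characters `η` mod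
`p^c` and `ξ` mod `p^m` there are `n` and a PRIMITIVE `χ` mod `pⁿ` with `χ(a) = η(a)⁻¹ ξ(a)` for every
`a` prime to `p` (the `χ` the interpolation clause of `IsUntwistedPAdicLFunction` asks the consumer to
supply). [cite: Bellaiche2021, Thm. 6.7.9] -/
theorem exists_isPrimitive_apply_eq_inv_mul {c m : ℕ} (η : DirichletCharacter ℂ_[p] (p ^ c))
    (ξ : DirichletCharacter ℂ_[p] (p ^ m)) :
    ∃ (n : ℕ) (χ : DirichletCharacter ℂ_[p] (p ^ n)), χ.IsPrimitive ∧
      ∀ a : ℕ, a.Coprime p → χ (a : ZMod (p ^ n)) = (η (a : ZMod (p ^ c)))⁻¹ * ξ (a : ZMod (p ^ m)) := by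
  have hp : p.Prime := Fact.out
  haveI : NeZero (p ^ (c + m)) := ⟨pow_ne_zero _ hp.ne_zero⟩
  have hc : p ^ c ∣ p ^ (c + m) := pow_dvd_pow p (Nat.le_add_right c m)
  have hm : p ^ m ∣ p ^ (c + m) := pow_dvd_pow p (Nat.le_add_left m c)
  set θ : DirichletCharacter ℂ_[p] (p ^ (c + m)) :=
    (DirichletCharacter.changeLevel hc η)⁻¹ * DirichletCharacter.changeLevel hm ξ with hθ
  obtain ⟨n, -, hn⟩ := (Nat.dvd_prime_pow hp).mp θ.conductor_dvd_level
  -- the values of `θ.primitiveCharacter` at integers prime to `p`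
  have hval : ∀ a : ℕ, a.Coprime p →
      θ.primitiveCharacter (a : ZMod θ.conductor) = (η (a : ZMod (p ^ c)))⁻¹ * ξ (a : ZMod (p ^ m)) := by
    intro a ha
    have ha' : IsCoprime (a : ℤ) ((p ^ (c + m) : ℕ) : ℤ) :=
      Nat.isCoprime_iff_coprime.mpr (Nat.Coprime.pow_right _ ha)
    have h1 := DirichletCharacter.primitiveCharacter_apply_of_isCoprime θ ha'
    simp only [Int.cast_natCast] at h1
    rw [h1, hθ, MulChar.mul_apply, MulChar.inv_apply_eq_inv']
    have h2 := DirichletCharacter.changeLevel_eq_cast_of_dvd' η hc ha'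
    have h3 := DirichletCharacter.changeLevel_eq_cast_of_dvd' ξ hm ha'
    simp only [Int.cast_natCast] at h2 h3
    rw [h2, h3]
  -- transport along `conductor θ = p^n`
  have key : ∀ (d : ℕ) (ψ : DirichletCharacter ℂ_[p] d), ψ.IsPrimitive → d = p ^ n →
      (∀ a : ℕ, a.Coprime p → ψ (a : ZMod d) = (η (a : ZMod (p ^ c)))⁻¹ * ξ (a : ZMod (p ^ m))) →
      ∃ χ : DirichletCharacter ℂ_[p] (p ^ n), χ.IsPrimitive ∧
        ∀ a : ℕ, a.Coprime p → χ (a : ZMod (p ^ n)) = (η (a : ZMod (p ^ c)))⁻¹ * ξ (a : ZMod (p ^ m)) := by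
    rintro d ψ hψ rfl hψv
    exact ⟨ψ, hψ, hψv⟩
  exact ⟨n, key θ.conductor θ.primitiveCharacter (DirichletCharacter.primitiveCharacter_isPrimitive θ) hn hval⟩

variable {N : ℕ} {f : CuspForm (CongruenceSubgroup.Gamma0 N) 2}

/-- **Uniqueness of the untwisted `p`-adic `L`-function** (Višik / Amice–Vélu in the ball-value
encoding): two systems of ball values with `IsUntwistedPAdicLFunction p f η α` are EQUAL — the
interpolation clause prescribes the value at every character of `Γ` (`gammaCharValue_eq` of D1, with
the primitive `χ` realising `η̄ξ` supplied by `exists_isPrimitive_apply_eq_inv_mul`) and additive ball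
values are determined by those values (`eq_of_forall_gammaCharValue_eq`). So D1's predicate defines AT
MOST ONE object; the promise "UNIQUE given (3)" of its docstring is this theorem.
[cite: Bellaiche2021, Thm. 6.2.13 (i) and Thm. 6.7.9] [cite: MazurTateTeitelbaum1986Invent, §I.11 and §I.14] -/
theorem eq_of_isUntwistedPAdicLFunction {c : ℕ} {η : DirichletCharacter ℂ_[p] (p ^ c)} {α : ℂ_[p]}
    {μ μ' : (n : ℕ) → ZMod (p ^ n) → ℂ_[p]} (h : IsUntwistedPAdicLFunction p f η α μ)
    (h' : IsUntwistedPAdicLFunction p f η α μ') : μ = μ' :=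
  eq_of_forall_gammaCharValue_eq h.1 h'.1 fun _ ξ hξ hξe hξo ↦ by
    obtain ⟨_, χ, hχ, hχη⟩ := exists_isPrimitive_apply_eq_inv_mul η ξ
    exact h.gammaCharValue_eq h' hξ hξe hξo hχ hχη

/-- **Uniqueness of the principal-series cyclotomic `3`-adic `L`-function `𝓛^η_W`** (D1,
`IsPSCyclotomicLFunctionOf W η α`), GRANTED Carayol's level statement (tree named fact
`IsNewformOf.level_eq_conductorNorm`, hypothesis `hlev`, as in the tree's `hasLambdaAnAt_iff_normLam_eq`):
the two witnesses then use the same newform (`IsNewformOf.unique`, multiplicity one at level `N_W`),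
and `eq_of_isUntwistedPAdicLFunction` applies. CONDITIONAL on `hlev` only; the fixed-newform statement
`eq_of_isUntwistedPAdicLFunction` is unconditional.
[cite: Bellaiche2021, Thm. 6.2.13 (i)] [cite: Carayol1986] [cite: MazurTateTeitelbaum1986Invent, §I.14] -/
theorem eq_of_isPSCyclotomicLFunctionOf
    (hlev : ∀ (N : ℕ) [NeZero N], IsNewformOf.level_eq_conductorNorm (N := N))
    {W : WeierstrassCurve ℚ} [W.IsElliptic] {η : DirichletCharacter ℂ_[3] (3 ^ 2)} {α : ℂ_[3]}
    {μ μ' : (n : ℕ) → ZMod (3 ^ n) → ℂ_[3]} (h : IsPSCyclotomicLFunctionOf W η α μ)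
    (h' : IsPSCyclotomicLFunctionOf W η α μ') : μ = μ' := by
  obtain ⟨N, _, f, hf, hL⟩ := h
  obtain ⟨N', _, f', hf', hL'⟩ := h'
  obtain rfl : N = W.conductorNorm ℤ := hlev N hf
  obtain rfl : N' = W.conductorNorm ℤ := hlev N' hf'
  obtain rfl : f = f' := hf.unique hf'
  exact eq_of_isUntwistedPAdicLFunction hL hL'

end Summit.BirchSwinnertonDyer.BirchSwinnertonDyer.Theorems.PSGammaUniqueness

end
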